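import Literature.NumberTheory.Automorphic.UnitaryGroupArchCharacter
import Literature.NumberTheory.Automorphic.UnitaryGroupArchSection
import Literature.Analysis.Matrix.KroneckerSumExp
import HarnessLib

/-!
# The lift of a one-parameter subgroup of `U(2,1)` along the archimedean projection `G′_∞ →* U(2,1)`

Topic `NumberTheory/Automorphic`; namespace `Literature.NumberTheory.Automorphic.UnitaryGroup`. Theorems with proofs and two
definitions with bodies (`archLieFrame`, `archLieLift`); no named fact, no `sorry`.

For a CM field `L`, `ι : L →+* ℂ`, `H ∈ M₃(L)` with a ball-model frame `T` at `ι` (`Tᴴ ι(H) T = J`), the archimedean projection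
★ `archProjUForm L ι H T hT : G′_∞ = U(H)(L⁺ ⊗ ℝ) →* U(2,1)_{Fin 2 ⊕ Fin 1}` (evaluation at the place of `ι`, the frame, the re-indexing
`Fin 3 ≃ Fin 2 ⊕ Fin 1`) and `X ∈ M_{Fin 2 ⊕ Fin 1}(ℂ)` (e.g. `X ∈ 𝔲(2,1)`):
* `archLieFrame T X = T · reindex⁻¹ X · T⁻¹ ∈ M₃(ℂ)` and **`archLieLift L ι T X ∈ M₃(L ⊗ ℝ)`**, the matrix whose complex coordinate at the
  place of `ι` is `embTwist ι (archLieFrame T X)` and whose other coordinates vanish;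
* `map_evalC_archLieLift_self ∕ _of_ne` (its coordinates), `map_exp_matrix` (a continuous ring map commutes with the matrix
  exponential entrywise), `map_evalC_exp_archLieLift_self ∕ _of_ne` (the coordinates of `exp (t • archLieLift X)`: `exp` of the
  `ι`-coordinate, `1` elsewhere);
* **`expGL_archLieLift_mem`**: `expGL (t • archLieLift X) ∈ G′_∞` when `exp (t • X) ∈ U(2,1)` for all `t` (membership is checked
  place by place, ★ `mem_arch_iff_forall`; at the place of `ι` it is the frame-conjugate of `exp (tX)`, un-twisted by ★ `archLocalOfEmb`);
* **`archProjUForm_expGL_archLieLift`**: `archProjUForm ⟨expGL (t • archLieLift X), _⟩ = expMem (t • X)` for `X ∈ 𝔲(2,1)` — the lifted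
  curve is a one-parameter subgroup of `GL₃(L ⊗ ℝ)` inside `G′_∞` projecting onto `t ↦ exp (tX)`.
This is the factor inclusion `G(F_{v₁}) ↪ G_∞ = ∏_{v ∣ ∞} G(F_v)` of [BorelJacquet1979, §4.1] on one-parameter subgroups, written on
matrices so that right derivatives of archimedean test functions on `GL₃(L ⊗ ℝ)` (★ `archRightDeriv`) can be taken along it.

Citations: A. Borel, H. Jacquet, *Automorphic forms and automorphic representations*, Corvallis 1979, §4.1 [BorelJacquet1979];
V. Platonov, A. Rapinchuk, *Algebraic groups and number theory* (1994), §2.3 (restriction of scalars at the infinite places).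
-/

noncomputable section

open NumberField NumberField.InfinitePlace NumberField.mixedEmbedding NormedSpace
open scoped Matrix MatrixGroups ComplexConjugate Classical

namespace Literature.NumberTheory.Automorphic.UnitaryGroup

open Literature.RepresentationTheory.KonnoKonno2007 Literature.RepresentationTheory.KonnoKonno2007.RealDualPair
open Literature.Geometry.ComplexHyperbolic Literature.Geometry.ComplexHyperbolic.BallModel
open Literature.Analysis.Matrix.KroneckerSum (exp_reindex)

/-! ## §0 A continuous ring map commutes with the matrix exponential entrywise -/

set_option backward.isDefEq.respectTransparency false in
/-- `(exp M).map f = exp (M.map f)` for a continuous ring homomorphism `f` of complete normed `ℚ`-algebras (Mathlib `map_exp` for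
`f.mapMatrix`). [cite: BorelJacquet1979, §4.1] -/
theorem map_exp_matrix {A B : Type*} [NormedCommRing A] [NormedAlgebra ℚ A] [CompleteSpace A] [NormedCommRing B]
    [NormedAlgebra ℚ B] {n : Type*} [Fintype n] [DecidableEq n] (f : A →+* B) (hf : Continuous f) (M : Matrix n n A) :
    (exp M).map f = exp (M.map f) := by
  open scoped Matrix.Norms.Operator in
  have h := map_exp f.mapMatrix (continuous_id.matrix_map hf) M
  simpa only [RingHom.mapMatrix_apply] using h

variable (L : Type) [Field L] [NumberField L] [IsCMField L] (ι : L →+* ℂ) (H : Matrix (Fin 3) (Fin 3) L) (T : GL (Fin 3) ℂ)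
  (hT : (T : Matrix (Fin 3) (Fin 3) ℂ)ᴴ * H.map ι * (T : Matrix (Fin 3) (Fin 3) ℂ) = J)

/-! ## §1 The lifted matrix -/

/-- `archLieFrame T X = T · (reindex⁻¹ X) · T⁻¹ ∈ M₃(ℂ)`: undo the re-indexing `Fin 3 ≃ Fin 2 ⊕ Fin 1` and the frame. [cite: BorelJacquet1979, §4.1] -/
def archLieFrame (X : Matrix (Fin 2 ⊕ Fin 1) (Fin 2 ⊕ Fin 1) ℂ) : Matrix (Fin 3) (Fin 3) ℂ :=
  (T : Matrix (Fin 3) (Fin 3) ℂ) * Matrix.reindex frameIdxFin1.symm frameIdxFin1.symm X * ((T⁻¹ : GL (Fin 3) ℂ) : Matrix (Fin 3) (Fin 3) ℂ)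

/-- `archLieFrame` is real-homogeneous. [cite: BorelJacquet1979, §4.1] -/
theorem archLieFrame_smul (t : ℝ) (X : Matrix (Fin 2 ⊕ Fin 1) (Fin 2 ⊕ Fin 1) ℂ) :
    archLieFrame T (t • X) = t • archLieFrame T X := by
  have h : Matrix.reindex frameIdxFin1.symm frameIdxFin1.symm (t • X) = t • Matrix.reindex frameIdxFin1.symm frameIdxFin1.symm X := rfl
  rw [archLieFrame, archLieFrame, h, Matrix.mul_smul, Matrix.smul_mul]

/-- **The lift `archLieLift L ι T X ∈ M₃(L ⊗ ℝ)`**: complex coordinate `embTwist ι (archLieFrame T X)` at the place of `ι`, `0` at the other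
(complex) coordinates and at the (absent) real coordinates. [cite: BorelJacquet1979, §4.1] -/
def archLieLift (X : Matrix (Fin 2 ⊕ Fin 1) (Fin 2 ⊕ Fin 1) ℂ) : Matrix (Fin 3) (Fin 3) (mixedSpace L) :=
  Matrix.of fun i j => ((fun _ => 0), Pi.single (placeOf L ι (isComplex_mk_of_isCMField L ι)) (embTwist L ι (archLieFrame T X i j)))

omit [NumberField L] [IsCMField L] in
/-- `embTwist` (the identity or complex conjugation) is real-linear. [cite: BorelJacquet1979, §4.1] -/
theorem embTwist_real_smul (t : ℝ) (z : ℂ) : embTwist L ι (t • z) = t • embTwist L ι z := by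
  by_cases h : (InfinitePlace.mk ι).embedding = ι
  · rw [embTwist_apply_of_eq L ι h, embTwist_apply_of_eq L ι h]
  · rw [embTwist_apply_of_ne L ι h, embTwist_apply_of_ne L ι h, Complex.real_smul, Complex.real_smul, map_mul,
      Complex.conj_ofReal]

/-- `archLieLift` is real-homogeneous. [cite: BorelJacquet1979, §4.1] -/
theorem archLieLift_smul (t : ℝ) (X : Matrix (Fin 2 ⊕ Fin 1) (Fin 2 ⊕ Fin 1) ℂ) :
    archLieLift L ι T (t • X) = t • archLieLift L ι T X := by
  refine Matrix.ext fun i j => Prod.ext ?_ ?_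
  · funext v
    simp only [archLieLift, Matrix.of_apply, Matrix.smul_apply, Prod.smul_fst, Pi.smul_apply, smul_zero]
  · simp only [archLieLift, Matrix.of_apply, Matrix.smul_apply, Prod.smul_snd, archLieFrame_smul, embTwist_real_smul,
      Pi.single_smul]

/-- The `ι`-coordinate of the lift: `embTwist ι (archLieFrame T X)`. [cite: BorelJacquet1979, §4.1] -/
theorem map_evalC_archLieLift_self (X : Matrix (Fin 2 ⊕ Fin 1) (Fin 2 ⊕ Fin 1) ℂ) :
    (archLieLift L ι T X).map (evalC L (placeOf L ι (isComplex_mk_of_isCMField L ι))) = (archLieFrame T X).map (embTwist L ι) := by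
  ext i j
  simp [archLieLift, evalC_apply]

/-- The other coordinates of the lift vanish. [cite: BorelJacquet1979, §4.1] -/
theorem map_evalC_archLieLift_of_ne {w : {w : InfinitePlace L // IsComplex w}} (hw : w ≠ placeOf L ι (isComplex_mk_of_isCMField L ι))
    (X : Matrix (Fin 2 ⊕ Fin 1) (Fin 2 ⊕ Fin 1) ℂ) : (archLieLift L ι T X).map (evalC L w) = 0 := by
  ext i j
  simp [archLieLift, evalC_apply, Pi.single_eq_of_ne hw]

/-- The `ι`-coordinate of `exp (archLieLift X)` is `(exp (archLieFrame T X)).map (embTwist ι)`. [cite: BorelJacquet1979, §4.1] -/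
theorem map_evalC_exp_archLieLift_self (X : Matrix (Fin 2 ⊕ Fin 1) (Fin 2 ⊕ Fin 1) ℂ) :
    (exp (archLieLift L ι T X)).map (evalC L (placeOf L ι (isComplex_mk_of_isCMField L ι))) =
      (exp (archLieFrame T X)).map (embTwist L ι) := by
  rw [map_exp_matrix _ (continuous_evalC L _), map_evalC_archLieLift_self, map_exp_matrix _ (continuous_embTwist L ι)]

/-- The other coordinates of `exp (archLieLift X)` are `1`. [cite: BorelJacquet1979, §4.1] -/
theorem map_evalC_exp_archLieLift_of_ne {w : {w : InfinitePlace L // IsComplex w}}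
    (hw : w ≠ placeOf L ι (isComplex_mk_of_isCMField L ι)) (X : Matrix (Fin 2 ⊕ Fin 1) (Fin 2 ⊕ Fin 1) ℂ) :
    (exp (archLieLift L ι T X)).map (evalC L w) = 1 := by
  rw [map_exp_matrix _ (continuous_evalC L _), map_evalC_archLieLift_of_ne L ι T hw, exp_zero]

/-! ## §2 The exponential of the lift lies in `G′_∞` and projects onto `exp (tX)` -/

/-- `exp (archLieFrame T X) = T · reindex⁻¹ (exp X) · T⁻¹`. [cite: BorelJacquet1979, §4.1] -/
theorem exp_archLieFrame (X : Matrix (Fin 2 ⊕ Fin 1) (Fin 2 ⊕ Fin 1) ℂ) :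
    exp (archLieFrame T X) =
      (T : Matrix (Fin 3) (Fin 3) ℂ) * Matrix.reindex frameIdxFin1.symm frameIdxFin1.symm (exp X) * ((T⁻¹ : GL (Fin 3) ℂ) : Matrix (Fin 3) (Fin 3) ℂ) := by
  rw [archLieFrame, Matrix.exp_units_conj, exp_reindex]

omit [NumberField L] [IsCMField L] in
/-- For `u ∈ U(2,1)_{Fin 2 ⊕ Fin 1}`, the frame-conjugate `T · reindex⁻¹ u · T⁻¹` lies in `U(ι(H))(ℂ)` (it is
`formEquivU21⁻¹ (u21FrameEquivFin1⁻¹ u)`). [cite: BorelJacquet1979, §4.1] -/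
theorem frame_conj_mem (u : (uFormGroup (Fin 2) (Fin 1)).carrier) :
    (T : Matrix (Fin 3) (Fin 3) ℂ) * Matrix.reindex frameIdxFin1.symm frameIdxFin1.symm ((u : GL (Fin 2 ⊕ Fin 1) ℂ) : Matrix (Fin 2 ⊕ Fin 1) (Fin 2 ⊕ Fin 1) ℂ) *
        ((T⁻¹ : GL (Fin 3) ℂ) : Matrix (Fin 3) (Fin 3) ℂ) =
      ((((formEquivU21 L H ι T (formCongr_eq_of_conjTranspose L ι H T hT)).symm (u21FrameEquivFin1.symm u) :
          unitaryGroupOfForm (starRingEnd ℂ) (H.map ι)) : GL (Fin 3) ℂ) : Matrix (Fin 3) (Fin 3) ℂ) := by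
  have h := coe_u21FrameEquivFin1 (u21FrameEquivFin1.symm u)
  rw [ContinuousMulEquiv.apply_symm_apply] at h
  rw [coe_formEquivU21_symm_apply, Units.val_mul, Units.val_mul, h, ← Matrix.reindex_symm, Equiv.symm_apply_apply]

include hT in
/-- **`exp (t • archLieLift X) ∈ G′_∞`** whenever `exp (sX) ∈ U(2,1)` for all `s` (e.g. `X ∈ 𝔲(2,1)`): place by place (★ `mem_arch_iff_forall`), the
`ι`-coordinate is the un-twist (★ `archLocalOfEmb`) of the frame-conjugate of `exp (tX)`, the others are `1`. [cite: BorelJacquet1979, §4.1] -/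
theorem expGL_archLieLift_mem (X : (uFormGroup (Fin 2) (Fin 1)).lie) (t : ℝ) :
    expGL (t • archLieLift L ι T (X : Matrix (Fin 2 ⊕ Fin 1) (Fin 2 ⊕ Fin 1) ℂ)) ∈
      arch (↥(maximalRealSubfield L)) L (IsCMField.complexConj L) 3 H := by
  rw [mem_arch_iff_forall _ L (IsCMField.complexConj L) 3 H (IsCMField.complexConj_ne_one L) (complexConj_smul_infinitePlace L)]
  intro w
  rw [← archLieLift_smul]
  by_cases hw : w = placeOf L ι (isComplex_mk_of_isCMField L ι)
  · subst hw
    -- the `ι`-coordinate: `GL₃(embTwist) (formEquivU21⁻¹ (u21FrameEquivFin1⁻¹ (exp tX)))`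
    set u : unitaryGroupOfForm (starRingEnd ℂ) (H.map ι) :=
      (formEquivU21 L H ι T (formCongr_eq_of_conjTranspose L ι H T hT)).symm
        (u21FrameEquivFin1.symm ((uFormGroup (Fin 2) (Fin 1)).expMem (t • X))) with hu
    have key : Matrix.GeneralLinearGroup.map (evalC L (placeOf L ι (isComplex_mk_of_isCMField L ι)))
        (expGL (archLieLift L ι T (t • (X : Matrix (Fin 2 ⊕ Fin 1) (Fin 2 ⊕ Fin 1) ℂ)))) =
        (archLocalOfEmb L 3 H ι (isComplex_mk_of_isCMField L ι) u : archLocal L 3 H _) := by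
      refine Units.ext ?_
      rw [coe_archLocalOfEmb]
      change (exp (archLieLift L ι T (t • (X : Matrix (Fin 2 ⊕ Fin 1) (Fin 2 ⊕ Fin 1) ℂ)))).map (evalC L _) =
        (((u : GL (Fin 3) ℂ)) : Matrix (Fin 3) (Fin 3) ℂ).map (embTwist L ι)
      rw [map_evalC_exp_archLieLift_self, exp_archLieFrame, hu, ← frame_conj_mem L ι H T hT, RealMatrixGroup.coe_expMem, coe_expGL]
      rfl
    rw [key]
    exact (archLocalOfEmb L 3 H ι (isComplex_mk_of_isCMField L ι) u).2
  · have key : Matrix.GeneralLinearGroup.map (evalC L w)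
        (expGL (archLieLift L ι T (t • (X : Matrix (Fin 2 ⊕ Fin 1) (Fin 2 ⊕ Fin 1) ℂ)))) = 1 := by
      refine Units.ext ?_
      change (exp (archLieLift L ι T (t • (X : Matrix (Fin 2 ⊕ Fin 1) (Fin 2 ⊕ Fin 1) ℂ)))).map (evalC L w) = 1
      rw [map_evalC_exp_archLieLift_of_ne L ι T hw]
    rw [key]
    exact one_mem _

/-- **The lifted one-parameter subgroup projects onto `t ↦ exp (tX)`**: `archProjUForm ⟨expGL (t • archLieLift X), _⟩ = expMem (t • X)` for
`X ∈ 𝔲(2,1)` (the frame and the twist cancel: ★ `coe_archProjU21Emb_apply`, ★ `coe_archAtEmb_eq_map_embTwist`, ★ `embTwist_embTwist`).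
[cite: BorelJacquet1979, §4.1] -/
theorem archProjUForm_expGL_archLieLift (X : (uFormGroup (Fin 2) (Fin 1)).lie) (t : ℝ) :
    archProjUForm L ι H T hT ⟨expGL (t • archLieLift L ι T (X : Matrix (Fin 2 ⊕ Fin 1) (Fin 2 ⊕ Fin 1) ℂ)),
        expGL_archLieLift_mem L ι H T hT X t⟩ = (uFormGroup (Fin 2) (Fin 1)).expMem (t • X) := by
  have hsmul : ((t • X : (uFormGroup (Fin 2) (Fin 1)).lie) : Matrix (Fin 2 ⊕ Fin 1) (Fin 2 ⊕ Fin 1) ℂ) =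
      t • (X : Matrix (Fin 2 ⊕ Fin 1) (Fin 2 ⊕ Fin 1) ℂ) := rfl
  -- the `ι`-coordinate of `exp (t • X̃)`, un-twisted, is `exp (archLieFrame T (tX))`
  have h1 : ((Matrix.GeneralLinearGroup.map (embTwist L ι)
      ((archAt _ L (IsCMField.complexConj L) 3 H (placeOf L ι (isComplex_mk_of_isCMField L ι))
          (complexConj_smul_infinitePlace L _) (IsCMField.complexConj_ne_one L)
          ⟨expGL (t • archLieLift L ι T (X : Matrix (Fin 2 ⊕ Fin 1) (Fin 2 ⊕ Fin 1) ℂ)), expGL_archLieLift_mem L ι H T hT X t⟩ :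
            archLocal L 3 H _) : GL (Fin 3) ℂ) : GL (Fin 3) ℂ) : Matrix (Fin 3) (Fin 3) ℂ) =
        exp (archLieFrame T (t • (X : Matrix (Fin 2 ⊕ Fin 1) (Fin 2 ⊕ Fin 1) ℂ))) := by
    change (((exp (t • archLieLift L ι T (X : Matrix (Fin 2 ⊕ Fin 1) (Fin 2 ⊕ Fin 1) ℂ))).map (evalC L _)).map
      (embTwist L ι)) = _
    have hinv : (embTwist L ι) ∘ (embTwist L ι) = id := funext fun z => embTwist_embTwist L ι z
    rw [← archLieLift_smul, map_evalC_exp_archLieLift_self, Matrix.map_map, hinv, Matrix.map_id]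
  -- the frame cancels
  have h2 : ∀ R : Matrix (Fin 3) (Fin 3) ℂ,
      ((T⁻¹ : GL (Fin 3) ℂ) : Matrix (Fin 3) (Fin 3) ℂ) *
          ((T : Matrix (Fin 3) (Fin 3) ℂ) * R * ((T⁻¹ : GL (Fin 3) ℂ) : Matrix (Fin 3) (Fin 3) ℂ)) * (T : Matrix (Fin 3) (Fin 3) ℂ) = R := by
    intro R
    calc _ = (((T⁻¹ : GL (Fin 3) ℂ) : Matrix (Fin 3) (Fin 3) ℂ) * (T : Matrix (Fin 3) (Fin 3) ℂ)) * R *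
          (((T⁻¹ : GL (Fin 3) ℂ) : Matrix (Fin 3) (Fin 3) ℂ) * (T : Matrix (Fin 3) (Fin 3) ℂ)) := by simp only [mul_assoc]
      _ = R := by rw [Units.inv_mul, one_mul, mul_one]
  refine Subtype.ext (Units.ext ?_)
  rw [archProjUForm_apply, coe_u21FrameEquivFin1, RealMatrixGroup.coe_expMem, coe_expGL, hsmul]
  dsimp only [mat]
  rw [archProjU21EmbCM, coe_archProjU21Emb_apply,
    coe_archAtEmb_eq_map_embTwist (↥(maximalRealSubfield L)) L (IsCMField.complexConj L) 3 H (IsCMField.complexConj_ne_one L)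
      (complexConj_smul_infinitePlace L) ι (isComplex_mk_of_isCMField L ι),
    Units.val_mul, Units.val_mul, h1, exp_archLieFrame,
    h2, ← Matrix.reindex_symm, Equiv.apply_symm_apply]

end Literature.NumberTheory.Automorphic.UnitaryGroup

end
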